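import Summits.MatrixMultiplication.MatrixMultiplication.Theorems.AbelianSTPPCensusTAKnap473Defs

/-!
# T_A/473 certificate: kernel evaluation, volumes `331 … 473` (segment 5)

Cell mm-stpp (rung F-M1), OPTIONAL leaf `NoAbelianSTPPHost_2371_473`; checker and checkpoint rows in `AbelianSTPPCensusTAKnap473Defs.lean`
(= the landed T_A/450 checker `TAKnap` at universe `473`, `Bmax = 354`, gains `gainOf2371x`).  `decide` with kernel reduction (standard
axioms, default heartbeats; no `native_decide`).  Each segment recomputes the next checkpoint row from the previous one and checks every
order `451 … 473` against every volume of its range; consumed by `TAKnap473.seg_sound` / `TAKnap473.loopVR_sound` in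
`AbelianSTPPCensusLeafTA473Closed.lean`.
WHAT THIS IS NOT: arithmetic on shape lists only; no statement about STPP families or `ω`.
-/

set_option linter.dupNamespace false
set_option autoImplicit false

namespace Summit.MatrixMultiplication.MatrixMultiplication.Theorems.TAKnap473

/-- Segment 5: volumes `331 … 473` from `row330`, all order checks `451 … 473` passing (the final row is not recorded). [original] -/
theorem seg5 : (loopVR 451 23 143 331 row330).1 = true := by decide +kernel

end Summit.MatrixMultiplication.MatrixMultiplication.Theorems.TAKnap473
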